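import Summits.ResolutionOfSingularities.ResolutionOfSingularities.Theorems.PurelyInseparableDim4ScopeBlindSubst
import Summits.ResolutionOfSingularities.ResolutionOfSingularities.Theorems.PurelyInseparableDim4WinCertAllFields
import HarnessLib

/-!
# `substBlindB`: the 𝔽_p CERTIFICATE FORMAT for UNIFORM-OUT BY SUBSTITUTION — one `decide` over the prime field, blindness at
# every point of the witness variety over every field (cell `res-dim4-pi`, ∀K column; interface asked by res-dim4-typ-3g8)

[OURS · counted 0 · certificate format for OUR frame] Nothing here is a statement about resolution of singularities.
Seat res-dim4-p-8 g3.  `…ScopeBlindSubst` proved `ScopeBlind.not_inCoordinateScope_step_of_subst`: a fixed polynomial substitution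
`σ` killing the witness ideal makes the child at every `σ`-fixed point blind.  This file turns its hypotheses into a Boolean on
term lists, checkable by `decide` over `ZMod p` (or any computable field), and transports them along any `f : k →+* K`:

* §1 term-list substitution `substL4 σ L` (`Σ c · ∏ (σ i)^{eᵢ}`, built from p-13's `mulTL`/`mulL`/`powL`) with
  `aeval_evalT_substL4`; naturality `aeval_map_comm`, `aeval_killT_map`;
* §2 **`substBlindB p G σ T α₀`** — (i) `σ i ≡ 0` for `i ∈ T`; (ii) `σ i` has a live non-constant monomial for `i ∉ T`;
  (iii) `substL4 σ (hasseL α G) ≡ 0` for every `α ∈ idxLT p`; (iv) `0 < |α₀| < p`; (v) the `x_T`-free part of `hasseL α₀ G` is `≢ 0`;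
* §3 **`not_inCoordinateScope_step_map_of_substBlindB`** (res-dim4-typ-3g8's v2 interface): for a presented state `s` over `k`,
  `substBlindB p (chartL p S j s.L) σ T α₀ = true` ⟹ for EVERY field `K` of characteristic `p`, every `f : k →+* K` and every
  `b : Fin 4 → K` with `eval b ((evalT (σ i)) ⊗ K) = b i`, the child `CentreBlowup.step p S j b (s ⊗ K)` is OUT of coordinate scope;
* §4 acceptance (`decide`, `p = 2`): eng-w2's smallest witness shape `(x_j, x₃ + x₄)` on a literal state — `planeSpec =
  x₁x₂²(x₃ + x₄)`, divisor centre `V(z, x₂)`, `x₂`-chart: `G = chartL … = x₁(x₃ + x₄)`, `σ = (0, x₂, x₄, x₄)` over `𝔽₂` (`−x₄ = x₄`),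
  `T = {x₁}`, `α₀ = e₁` ⇒ `substBlindB 2 … = true` (`substBlindB_planeSpec`), hence for every field of characteristic 2 and every
  `b` with `b₁ = 0`, `b₃ = b₄` the child is blind (`planeSpec_children_blind`).

OURS; counted 0.  bears_on: LADDER-RESOLUTION:D157-DOOR2 (res-dim4-pi · ∀K column · certificate KIND «SUBST leaf»).  Supports
stmt-ResolutionOfSingularities-16155 (helper).
-/

set_option linter.dupNamespace false -- mandated namespace of this single-conjunct summit

noncomputable section

open MvPolynomial Finset
open scoped BigOperators

namespace Summit.ResolutionOfSingularities.ResolutionOfSingularities.Theorems.PIDim4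

namespace ScopeBlind

open Literature.AlgebraicGeometry.Resolution
open Literature.AlgebraicGeometry.Resolution.CentreBlowup
open Literature.AlgebraicGeometry.Resolution.Hauser2010
open StepKit ScopeCover ScopeDynamics

variable {k : Type} [Field k]

/-! ## §1 Term-list substitution -/

/-- `∏ᵢ (σ i)^{eᵢ}` as a term list. [folklore] -/
def prodPow4 (σ : Fin 4 → Terms 4 k) (e : Fin 4 → ℕ) : Terms 4 k :=
  mulL (mulL (mulL (powL (σ 0) (e 0)) (powL (σ 1) (e 1))) (powL (σ 2) (e 2))) (powL (σ 3) (e 3))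

/-- transfer of `prodPow4`. [folklore] -/
theorem evalT_prodPow4 (σ : Fin 4 → Terms 4 k) (e : Fin 4 → ℕ) :
    evalT (prodPow4 σ e) = ∏ i, evalT (σ i) ^ e i := by
  simp only [prodPow4, evalT_mulL, evalT_powL, Fin.prod_univ_four]

/-- **substitution on term lists**: `xᵢ ↦ σ i`. [folklore] -/
def substL4 (σ : Fin 4 → Terms 4 k) : Terms 4 k → Terms 4 k
  | [] => []
  | t :: L => mulTL (fun _ => 0, t.2) (prodPow4 σ t.1) ++ substL4 σ L

/-- **transfer**: `aeval (evalT ∘ σ) (evalT L) = evalT (substL4 σ L)`. [folklore] -/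
theorem aeval_evalT_substL4 (σ : Fin 4 → Terms 4 k) (L : Terms 4 k) :
    MvPolynomial.aeval (fun i => evalT (σ i)) (evalT L) = evalT (substL4 σ L) := by
  induction L with
  | nil => simp [substL4]
  | cons t L ih =>
    rw [evalT_cons, map_add, ih, substL4, evalT_append, evalT_mulTL, evalT_prodPow4, monomial_expo_eq, map_mul,
      MvPolynomial.algHom_C, MvPolynomial.algebraMap_eq, map_prod, monomial_expo_eq]
    simp only [map_pow, MvPolynomial.aeval_X, pow_zero, Finset.prod_const_one, mul_one]

/-- naturality of substitution: `aeval (σ ⊗ K) (P ⊗ K) = (aeval σ P) ⊗ K`. [folklore] -/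
theorem aeval_map_comm {K : Type} [Field K] (f : k →+* K) (σ : Fin 4 → MvPolynomial (Fin 4) k)
    (P : MvPolynomial (Fin 4) k) :
    MvPolynomial.aeval (fun i => MvPolynomial.map f (σ i)) (MvPolynomial.map f P) =
      MvPolynomial.map f (MvPolynomial.aeval σ P) := by
  have h : (MvPolynomial.aeval (R := K) (fun i => MvPolynomial.map f (σ i))).toRingHom.comp (MvPolynomial.map f) =
      (MvPolynomial.map f).comp (MvPolynomial.aeval (R := k) σ).toRingHom := by
    refine MvPolynomial.ringHom_ext (fun c => ?_) (fun i => ?_)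
    · simp only [RingHom.comp_apply, AlgHom.toRingHom_eq_coe, AlgHom.coe_toRingHom, map_C, MvPolynomial.algHom_C,
        MvPolynomial.algebraMap_eq]
    · simp only [RingHom.comp_apply, AlgHom.toRingHom_eq_coe, AlgHom.coe_toRingHom, map_X, MvPolynomial.aeval_X]
  exact congrArg (fun φ : MvPolynomial (Fin 4) k →+* MvPolynomial (Fin 4) K => φ P) h

/-- naturality of `x_T ↦ 0`. [folklore] -/
theorem aeval_killT_map {K : Type} [Field K] (f : k →+* K) (T : Finset (Fin 4)) (P : MvPolynomial (Fin 4) k) :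
    MvPolynomial.aeval (R := K) (fun i : Fin 4 => if i ∈ T then (0 : MvPolynomial (Fin 4) K) else X i)
        (MvPolynomial.map f P) =
      MvPolynomial.map f
        (MvPolynomial.aeval (R := k) (fun i : Fin 4 => if i ∈ T then (0 : MvPolynomial (Fin 4) k) else X i) P) := by
  have hσ : (fun i : Fin 4 => if i ∈ T then (0 : MvPolynomial (Fin 4) K) else X i) =
      fun i => MvPolynomial.map f (if i ∈ T then (0 : MvPolynomial (Fin 4) k) else X i) := by
    funext i
    split_ifs <;> simp
  rw [hσ, aeval_map_comm]

/-! ## §2 The checker -/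

variable [DecidableEq k]

/-- **`substBlindB p G σ T α₀`**: the five decidable hypotheses of `not_inCoordinateScope_step_of_subst` on term lists. OURS.
[folklore] -/
def substBlindB (p : ℕ) (G : Terms 4 k) (σ : Fin 4 → Terms 4 k) (T : Finset (Fin 4)) (α₀ : Fin 4 → ℕ) : Bool :=
  decide (∀ i ∈ T, StepKit.equivB (σ i) [] = true) &&
    decide (∀ i : Fin 4, i ∉ T → ∃ e ∈ live (σ i), e ≠ 0) &&
    ((idxLT p).all fun α => StepKit.equivB (substL4 σ (hasseL α G)) []) &&
    decide (0 < ∑ i, α₀ i ∧ ∑ i, α₀ i < p) &&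
    !(StepKit.equivB ((hasseL α₀ G).filter fun t => ∀ i ∈ T, t.1 i = 0) [])

/-! ## §3 Soundness over every field -/

/-- a live non-zero exponent of `L` makes `(evalT L) ⊗ K` differ from every constant. [folklore] -/
theorem map_evalT_ne_C {K : Type} [Field K] (f : k →+* K) {L : Terms 4 k} {e : Fin 4 → ℕ}
    (he : e ∈ live L) (hne : e ≠ 0) (c : K) : MvPolynomial.map f (evalT L) ≠ C c := by
  classical
  have hcoeff : coeffAt L e ≠ 0 := by
    unfold live at he
    exact (List.mem_filter.mp he).2 |> fun h => by simpa using h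
  intro h
  have := congrArg (coeff (expo e)) h
  rw [coeff_map, coeff_expo_evalT, coeff_C, if_neg (fun h0 => hne ((expo_eq_zero_iff e).mp h0.symm))] at this
  exact hcoeff ((map_eq_zero_iff f f.injective).mp this)

/-- **SOUNDNESS (res-dim4-typ-3g8's v2 interface).**  If `substBlindB p (chartL p S j s.L) σ T α₀ = true` for a presented state
`s` over `k`, then over EVERY field `K` of characteristic `p`, along every `f : k →+* K`, at EVERY point `b` fixed by the mapped
substitution (`eval b ((evalT (σ i)) ⊗ K) = b i`), the child `CentreBlowup.step p S j b (s ⊗ K)` is OUT of coordinate scope.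
OURS. [folklore] -/
theorem not_inCoordinateScope_step_map_of_substBlindB {p : ℕ} [Fact p.Prime] {s : SData 4 k} {S : Finset (Fin 4)}
    {j : Fin 4} {σ : Fin 4 → Terms 4 k} {T : Finset (Fin 4)} {α₀ : Fin 4 → ℕ}
    (h : substBlindB p (chartL p S j s.L) σ T α₀ = true)
    (K : Type) [Field K] [CharP K p] [DecidableEq K] (f : k →+* K) (b : Fin 4 → K)
    (hb : ∀ i : Fin 4, MvPolynomial.eval b (MvPolynomial.map f (evalT (σ i))) = b i) :
    ¬ InCoordinateScope p
      (CentreBlowup.step p S j b (⟨MvPolynomial.map f s.toState.F, s.toState.r, s.toState.exc⟩ : State K)).F := by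
  classical
  simp only [substBlindB, Bool.and_eq_true, decide_eq_true_eq, List.all_eq_true, Bool.not_eq_true'] at h
  obtain ⟨⟨⟨⟨hT, hnc⟩, hJ⟩, hα₀⟩, hW⟩ := h
  have hdeg : (expo α₀).degree = ∑ i, α₀ i := degree_expo α₀
  -- the chart transform of the mapped state is the mapped `chartL`
  have hG : chartTransform p S j (MvPolynomial.map f s.toState.F) = MvPolynomial.map f (evalT (chartL p S j s.L)) := by
    rw [SData.toState_F, WinCertAllFields.chartTransform_map, chartTransform_evalT]
  refine not_inCoordinateScope_step_of_subst p S j _ (fun i => MvPolynomial.map f (evalT (σ i))) T (fun i hi => ?_)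
    (fun i hi c => ?_) (fun α h0 hq => ?_) (expo α₀) (by rw [hdeg]; exact hα₀.1) (by rw [hdeg]; exact hα₀.2) ?_ b hb
  · rw [(evalT_eq_zero_iff _).mpr (hT i hi), map_zero]
  · obtain ⟨e, he, hne⟩ := hnc i hi
    exact map_evalT_ne_C f he hne c
  · change MvPolynomial.aeval (fun i => MvPolynomial.map f (evalT (σ i)))
      (hasseDeriv α (chartTransform p S j (MvPolynomial.map f s.toState.F))) = 0
    rw [hG, IsolationConverse.hasseDeriv_map, aeval_map_comm, ← expo_coe α, hasseDeriv_evalT, aeval_evalT_substL4,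
      (evalT_eq_zero_iff _).mpr (hJ (⇑α) (mem_idxLT h0 hq)), map_zero]
  · change MvPolynomial.aeval (R := K) (fun i : Fin 4 => if i ∈ T then (0 : MvPolynomial (Fin 4) K) else X i)
      (hasseDeriv (expo α₀) (chartTransform p S j (MvPolynomial.map f s.toState.F))) ≠ 0
    rw [hG, IsolationConverse.hasseDeriv_map, aeval_killT_map, hasseDeriv_evalT, aeval_killT_evalT]
    intro h0
    apply (not_congr (evalT_eq_zero_iff _)).mpr (by rw [hW]; exact Bool.false_ne_true)
    exact (map_eq_zero_iff _ (MvPolynomial.map_injective f f.injective)).mp h0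

/-- the `ZMod p` entry point: every field of characteristic `p`. OURS. [folklore] -/
theorem not_inCoordinateScope_step_cast_of_substBlindB {p : ℕ} [Fact p.Prime] {s : SData 4 (ZMod p)} {S : Finset (Fin 4)}
    {j : Fin 4} {σ : Fin 4 → Terms 4 (ZMod p)} {T : Finset (Fin 4)} {α₀ : Fin 4 → ℕ}
    (h : substBlindB p (chartL p S j s.L) σ T α₀ = true)
    (K : Type) [Field K] [CharP K p] [DecidableEq K] (b : Fin 4 → K)
    (hb : ∀ i : Fin 4, MvPolynomial.eval b (MvPolynomial.map (ZMod.castHom (dvd_refl p) K) (evalT (σ i))) = b i) :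
    ¬ InCoordinateScope p
      (CentreBlowup.step p S j b
        (⟨MvPolynomial.map (ZMod.castHom (dvd_refl p) K) s.toState.F, s.toState.r, s.toState.exc⟩ : State K)).F :=
  not_inCoordinateScope_step_map_of_substBlindB h K (ZMod.castHom (dvd_refl p) K) b hb

/-! ## §4 Acceptance: the plane witness `(x₁, x₃ + x₄)` by `decide` over `𝔽₂` -/

/-- the state `x₁x₂²x₃ + x₁x₂²x₄` (its `x₂`-chart transform along the divisor `V(z, x₂)` is `x₁x₃ + x₁x₄ = x₁(x₃ + x₄)`),
`r = 0`, `exc = ∅`, over `𝔽₂`.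
[OURS · specimen] -/
def planeSpec : SData 4 (ZMod 2) := ⟨[(![1, 2, 1, 0], 1), (![1, 2, 0, 1], 1)], ![0, 0, 0, 0], ∅⟩

/-- its substitution leaf: `σ = (0, x₂, x₄, x₄)` (`−x₄ = x₄` in characteristic `2`), `T = {x₁}`, `α₀ = e₁`. [OURS · ‖ K] -/
theorem substBlindB_planeSpec :
    substBlindB 2 (chartL 2 {1} 1 planeSpec.L) ![[], [(![0, 1, 0, 0], 1)], [(![0, 0, 0, 1], 1)], [(![0, 0, 0, 1], 1)]] {0}
      ![1, 0, 0, 0] = true := by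
  decide

/-- **hence, over EVERY field of characteristic 2, at EVERY point `b` with `b₁ = 0`, `b₃ = b₄` of the exceptional divisor of the
blow-up of `V(z, x₂)` at `planeSpec`, the child is OUT of coordinate scope** — the certificate form of `plane_family_blind`.
[OURS · ‖ K] -/
theorem planeSpec_children_blind (K : Type) [Field K] [CharP K 2] [DecidableEq K] (b : Fin 4 → K) (hb1 : b 0 = 0)
    (hb34 : b 2 = b 3) :
    ¬ InCoordinateScope 2
      (CentreBlowup.step 2 {1} 1 b
        (⟨MvPolynomial.map (ZMod.castHom (dvd_refl 2) K) planeSpec.toState.F, planeSpec.toState.r, planeSpec.toState.exc⟩ :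
          State K)).F := by
  refine not_inCoordinateScope_step_cast_of_substBlindB substBlindB_planeSpec K b fun i => ?_
  fin_cases i <;> simp [monomial_expo_eq, Fin.prod_univ_four, hb1, hb34]

end ScopeBlind

end Summit.ResolutionOfSingularities.ResolutionOfSingularities.Theorems.PIDim4

end
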